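import Summits.BirchSwinnertonDyer.BirchSwinnertonDyer.Theorems.ManinLocalTwoThreeShimuraIndexOfIrreducible
import Literature.NumberTheory.EllipticCurves.ManinConstantGamma1Gamma0LedgerProofs
import HarnessLib

/-!
# The `Γ₀(N)/Γ₁(N)` Manin ledger on the irreducible locus: `|c₀| = |c₁|`; E-an-67 / E-an-66 off rational `2`-torsion

Summit `BirchSwinnertonDyer`, route `ManinLocalTwoThree` (cell bsd-f2-manin), crux C2 `ManinOddAtFour`
(stmt-BirchSwinnertonDyer-22967); prover seat bsd-line-manin23-p1 (C2/C3 LEAD), gen 9.  Sequel to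
`ManinLocalTwoThreeShimuraIndexOfIrreducible.lean` (`W[p]` irreducible ⟹ `ShimuraIndexPrimeTo p`, `p² ∣ N` ⟹ `Λ₁ = Λ₀`)
combined with the tree's ledger `Literature/…/ManinConstantGamma1Gamma0LedgerProofs.lean` (`c₁ ∣ c₀ ∣ p c₁` at a
traceless prime; same newform for isogenous data).

* `natAbs_maninConstant₀_eq_natAbs_maninConstant₁_of_sq_dvd_of_hasIrreducibleModPGaloisRep` — for ISOGENOUS globally
  minimal `W₁ ~ W₀`, an optimal `X₁(N)`-datum `D₁` of `W₁`, a lattice-optimal `X₀(N)`-datum `D₀` of `W₀`, a prime `p`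
  with `p² ∣ N` and `W₀[p]` irreducible: `|c₀| = |c₁|` (Stevens' and Manin's optimal constants of the class agree up
  to sign).  At `4 ∣ N`: no rational `2`-torsion suffices (`…_of_four_dvd_of_noRationalTwoTorsion`); at `9 ∣ N`: no
  rational root of `Ψ₃` (`…_of_nine_dvd_of_forall_not_isRoot_Ψ₃`).
* **E-an-67♭ `shimuraLedgerAtFour_of_hasRationalTwoTorsion_weak`** — an's row E-an-67 `ShimuraLedger.ShimuraLedgerAtFour`
  with `HasRationalTwoTorsion W₀` in place of `HasNonBlindRationalTwoTorsion W₀` in the second alternative, PROVED: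
  `|c₀| = |c₁| ∨ (|c₀| = 2|c₁| ∧ W₀ has a rational 2-torsion point)`.
* **E-an-66♭ `totallyBlindGammaOneTransfer_of_not_hasRationalTwoTorsion`** — an's row E-an-66
  `TotallyBlindGammaOneTransfer` on the locus `W₀(ℚ)[2] = 0` (where «all rational 2-torsion blind» is vacuous), PROVED.

HONEST FRAMING: the remaining content of E-an-66/67 — «`|c₀| = 2|c₁|` forces a NON-blind rational `2`-torsion point»,
i.e. the index-`2` blind case and the index-`4` case of `[Λ₀ : Λ₁]` — is NOT proved here (it needs the Vélu/Néron
dictionary for the kernel of the Shimura cover, resp. «`Σ(N)` is of μ-type»).  Nothing here decides the parity of a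
Manin constant; C2, Manin's conjecture and BSD are NOT proved by this file.  No definitions, no sorry.
-/

set_option autoImplicit false
set_option linter.dupNamespace false

noncomputable section

open scoped Classical MatrixGroups ModularForm

open CongruenceSubgroup Complex WeierstrassCurve Literature.NumberTheory.EllipticCurves
  Literature.NumberTheory.EllipticCurves.ModularForms
open Summit.BirchSwinnertonDyer.Rank1Residual.ManinAdditive.ShimuraLedger

namespace Summit.BirchSwinnertonDyer.BirchSwinnertonDyer.Theorems.ManinLocalTwoThree

variable {W₁ W₀ : WeierstrassCurve ℚ} [W₁.IsElliptic] [W₁.IsGloballyMinimal] [W₀.IsElliptic]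
  [W₀.IsGloballyMinimal] {N : ℕ} [NeZero N]

/-! ### §1. `|c₀| = |c₁|` on the irreducible locus at a traceless level -/

/-- **Stevens' and Manin's optimal constants agree up to sign when `p² ∣ N` and `W₀[p]` is irreducible.**  For
isogenous globally minimal `W₁ ~ W₀`, an OPTIMAL `X₁(N)`-datum `D₁` of `W₁`, a lattice-optimal `X₀(N)`-datum `D₀` of
`W₀`: `|c₀| = |c₁|`.  (Same newform by `Gamma1ParametrizationData.f_eq_of_isIsogenous`; `Λ₁(f) = Λ₀(f)` by
`periodLatticeGamma1_eq_periodLattice_of_sq_dvd_of_hasIrreducibleModPGaloisRep`; then the tree's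
`natAbs_maninConstant₀_eq_of_periodLatticeGamma1_eq_periodLattice`.)
[cite: LingOesterle1991, Thm. 6] [cite: Ribet1988Shimura, Thm. 1 and §3] [cite: CesnaviciusNeururerSaha2023, Lemma 6.5 (shape)] -/
theorem natAbs_maninConstant₀_eq_natAbs_maninConstant₁_of_sq_dvd_of_hasIrreducibleModPGaloisRep
    (D₁ : Gamma1ParametrizationData W₁ N) (D₀ : ModularParametrizationData W₀ N) (hiso : IsIsogenous W₁ W₀)
    (h₁ : D₁.IsOptimal) (h₀ : ∀ z ∈ D₀.L.lattice, ∃ w ∈ periodLattice D₀.f, z = D₀.c * w)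
    {p : ℕ} (hp : p.Prime) (hpN : p ^ 2 ∣ N) (hirr : W₀.HasIrreducibleModPGaloisRep p) :
    D₀.maninConstant.natAbs = D₁.maninConstant.natAbs :=
  natAbs_maninConstant₀_eq_of_sq_dvd_of_hasIrreducibleModPGaloisRep W₀ D₁ D₀ h₁ h₀
    (D₁.f_eq_of_isIsogenous D₀ hiso) hp hpN hirr

/-- **`4 ∣ N`, `W₀` without rational `2`-torsion ⟹ `|c₀| = |c₁|`.** [cite: LingOesterle1991, Thm. 6] [cite: Ribet1988Shimura, Thm. 1 and §3] -/
theorem natAbs_maninConstant₀_eq_natAbs_maninConstant₁_of_four_dvd_of_noRationalTwoTorsion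
    (D₁ : Gamma1ParametrizationData W₁ N) (D₀ : ModularParametrizationData W₀ N) (hiso : IsIsogenous W₁ W₀)
    (h₁ : D₁.IsOptimal) (h₀ : ∀ z ∈ D₀.L.lattice, ∃ w ∈ periodLattice D₀.f, z = D₀.c * w) (h4 : 2 ^ 2 ∣ N)
    (hT : ∀ e : ℚ, ¬ W₀.twoTorsionPolynomial.toPoly.IsRoot e) :
    D₀.maninConstant.natAbs = D₁.maninConstant.natAbs := by
  refine natAbs_maninConstant₀_eq_natAbs_maninConstant₁_of_sq_dvd_of_hasIrreducibleModPGaloisRep D₁ D₀ hiso h₁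
    h₀ Nat.prime_two h4 ?_
  by_contra hred
  obtain ⟨e, he⟩ := (W₀.not_hasIrreducibleModPGaloisRep_two_iff_exists_isRoot_twoTorsionPolynomial).mp hred
  exact hT e he

/-- **`9 ∣ N`, `Ψ₃(W₀)` without a rational root ⟹ `|c₀| = |c₁|`.** [cite: LingOesterle1991, Thm. 6] [cite: Ribet1988Shimura, Thm. 1 and §3] -/
theorem natAbs_maninConstant₀_eq_natAbs_maninConstant₁_of_nine_dvd_of_forall_not_isRoot_Ψ₃
    (D₁ : Gamma1ParametrizationData W₁ N) (D₀ : ModularParametrizationData W₀ N) (hiso : IsIsogenous W₁ W₀)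
    (h₁ : D₁.IsOptimal) (h₀ : ∀ z ∈ D₀.L.lattice, ∃ w ∈ periodLattice D₀.f, z = D₀.c * w) (h9 : 3 ^ 2 ∣ N)
    (hΨ : ∀ x₀ : ℚ, ¬ W₀.Ψ₃.IsRoot x₀) :
    D₀.maninConstant.natAbs = D₁.maninConstant.natAbs :=
  natAbs_maninConstant₀_eq_natAbs_maninConstant₁_of_sq_dvd_of_hasIrreducibleModPGaloisRep D₁ D₀ hiso h₁ h₀
    Nat.prime_three h9 ((W₀.hasIrreducibleModPGaloisRep_three_iff_forall_not_isRoot_Ψ₃).mpr hΨ)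

/-! ### §2. E-an-67♭ and E-an-66♭ (the `Γ₀/Γ₁` ledger of the an planner, MEMO-an §58) -/

/-- On a model with `a₁ = a₃ = 0` the `2`-division cubic is `4·(x³ + a₂x² + a₄x + a₆)`, so a rational root of it
is a rational `2`-torsion abscissa in the sense of `ShimuraLedger.HasRationalTwoTorsion`. [folklore] -/
theorem hasRationalTwoTorsion_of_isRoot_twoTorsionPolynomial {W : WeierstrassCurve ℚ} (ha₁ : W.a₁ = 0)
    (ha₃ : W.a₃ = 0) {e : ℚ} (he : W.twoTorsionPolynomial.toPoly.IsRoot e) : HasRationalTwoTorsion W := by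
  refine ⟨e, ?_⟩
  have h : 4 * e ^ 3 + W.b₂ * e ^ 2 + 2 * W.b₄ * e + W.b₆ = 0 := by
    simpa [WeierstrassCurve.twoTorsionPolynomial, Cubic.toPoly, Polynomial.eval_add, Polynomial.eval_mul,
      Polynomial.eval_pow, Polynomial.eval_C, Polynomial.eval_X] using he
  simp only [WeierstrassCurve.b₂, WeierstrassCurve.b₄, WeierstrassCurve.b₆, ha₁, ha₃] at h
  linear_combination h / 4

/-- No rational `2`-torsion abscissa on an `a₁ = a₃ = 0` model ⟹ the `2`-division cubic has no rational root. [folklore] -/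
theorem forall_not_isRoot_twoTorsionPolynomial_of_not_hasRationalTwoTorsion {W : WeierstrassCurve ℚ}
    (ha₁ : W.a₁ = 0) (ha₃ : W.a₃ = 0) (hT : ¬ HasRationalTwoTorsion W) :
    ∀ e : ℚ, ¬ W.twoTorsionPolynomial.toPoly.IsRoot e :=
  fun _e he ↦ hT (hasRationalTwoTorsion_of_isRoot_twoTorsionPolynomial ha₁ ha₃ he)

/-- **E-an-67♭ (PROVED)** — an's `ShimuraLedgerAtFour` with «rational `2`-torsion» in place of «NON-blind rational
`2`-torsion»: for isogenous globally minimal `W₁ ~ W₀`, `D₁` an optimal `X₁(N)`-datum, `D₀` a lattice-optimal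
`X₀(N)`-datum, `4 ∣ N`, `a₁(W₀) = a₃(W₀) = 0`: `|c₀| = |c₁|`, or `|c₀| = 2|c₁|` AND `W₀` has a rational `2`-torsion
point (the tree ledger's numeric dichotomy + §1).  The blindness clause of E-an-67 proper is NOT proved.
[cite: LingOesterle1991, Thm. 6] [cite: Ribet1988Shimura, Thm. 1 and §3] [cite: CesnaviciusNeururerSaha2023, Lemma 6.5 (shape)] -/
theorem shimuraLedgerAtFour_weak :
    ∀ (W₁ W₀ : WeierstrassCurve ℚ) [W₁.IsElliptic] [W₁.IsGloballyMinimal] [W₀.IsElliptic] [W₀.IsGloballyMinimal]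
      {N : ℕ} [NeZero N] (D₁ : Gamma1ParametrizationData W₁ N) (D₀ : ModularParametrizationData W₀ N),
      IsIsogenous W₁ W₀ → D₁.IsOptimal → (∀ z ∈ D₀.L.lattice, ∃ w ∈ periodLattice D₀.f, z = D₀.c * w) →
      2 ^ 2 ∣ N → W₀.a₁ = 0 → W₀.a₃ = 0 →
      D₀.maninConstant.natAbs = D₁.maninConstant.natAbs ∨
        (D₀.maninConstant.natAbs = 2 * D₁.maninConstant.natAbs ∧ HasRationalTwoTorsion W₀) := by
  intro W₁ W₀ _ _ _ _ N _ D₁ D₀ hiso h₁ h₀ h4 ha₁ ha₃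
  by_cases hT : HasRationalTwoTorsion W₀
  · rcases natAbs_maninConstant₀_eq_or_eq_two_mul_of_four_dvd_level D₁ D₀ hiso h₁ h₀ h4 with h | h
    · exact Or.inl h
    · exact Or.inr ⟨h, hT⟩
  · exact Or.inl (natAbs_maninConstant₀_eq_natAbs_maninConstant₁_of_four_dvd_of_noRationalTwoTorsion D₁ D₀
      hiso h₁ h₀ h4 (forall_not_isRoot_twoTorsionPolynomial_of_not_hasRationalTwoTorsion ha₁ ha₃ hT))

/-- **E-an-66♭ (PROVED)** — an's `TotallyBlindGammaOneTransfer` on the locus `W₀(ℚ)[2] = 0`: for isogenous globally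
minimal `W₁ ~ W₀`, `D₁` optimal `X₁(N)`-datum, `D₀` lattice-optimal `X₀(N)`-datum, `4 ∣ N`, `a₁(W₀) = a₃(W₀) = 0`
and NO rational `2`-torsion abscissa: `|c₀| = |c₁|`.  (The all-blind `ℤ/2` case of E-an-66 is NOT proved.)
[cite: LingOesterle1991, Thm. 6] [cite: Ribet1988Shimura, Thm. 1 and §3] -/
theorem totallyBlindGammaOneTransfer_of_not_hasRationalTwoTorsion
    (D₁ : Gamma1ParametrizationData W₁ N) (D₀ : ModularParametrizationData W₀ N) (hiso : IsIsogenous W₁ W₀)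
    (h₁ : D₁.IsOptimal) (h₀ : ∀ z ∈ D₀.L.lattice, ∃ w ∈ periodLattice D₀.f, z = D₀.c * w) (h4 : 2 ^ 2 ∣ N)
    (ha₁ : W₀.a₁ = 0) (ha₃ : W₀.a₃ = 0) (hT : ¬ HasRationalTwoTorsion W₀) :
    D₀.maninConstant.natAbs = D₁.maninConstant.natAbs :=
  natAbs_maninConstant₀_eq_natAbs_maninConstant₁_of_four_dvd_of_noRationalTwoTorsion D₁ D₀ hiso h₁ h₀ h4
    (forall_not_isRoot_twoTorsionPolynomial_of_not_hasRationalTwoTorsion ha₁ ha₃ hT)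

/-- Hence E-an-67 proper (`ShimuraLedgerAtFour`) follows from ONE residual statement: at `4 ∣ N`, a lattice-optimal
`W₀` with `a₁ = a₃ = 0`, `|c₀| = 2|c₁|` and a rational `2`-torsion point has a NON-blind one (PROVED reduction).
[cite: CesnaviciusNeururerSaha2023, Lemma 6.5 (shape)] -/
theorem shimuraLedgerAtFour_of_residual
    (hres : ∀ (W₁ W₀ : WeierstrassCurve ℚ) [W₁.IsElliptic] [W₁.IsGloballyMinimal] [W₀.IsElliptic]
      [W₀.IsGloballyMinimal] {N : ℕ} [NeZero N] (D₁ : Gamma1ParametrizationData W₁ N)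
      (D₀ : ModularParametrizationData W₀ N),
      IsIsogenous W₁ W₀ → D₁.IsOptimal → (∀ z ∈ D₀.L.lattice, ∃ w ∈ periodLattice D₀.f, z = D₀.c * w) →
      2 ^ 2 ∣ N → W₀.a₁ = 0 → W₀.a₃ = 0 →
      D₀.maninConstant.natAbs = 2 * D₁.maninConstant.natAbs → HasRationalTwoTorsion W₀ →
      HasNonBlindRationalTwoTorsion W₀) :
    ShimuraLedgerAtFour := by
  intro W₁ W₀ _ _ _ _ N _ D₁ D₀ hiso h₁ h₀ h4 ha₁ ha₃
  rcases shimuraLedgerAtFour_weak W₁ W₀ D₁ D₀ hiso h₁ h₀ h4 ha₁ ha₃ with h | ⟨h, hT⟩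
  · exact Or.inl h
  · exact Or.inr ⟨h, hres W₁ W₀ D₁ D₀ hiso h₁ h₀ h4 ha₁ ha₃ h hT⟩

end Summit.BirchSwinnertonDyer.BirchSwinnertonDyer.Theorems.ManinLocalTwoThree

end
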